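import Summits.AnomalousDissipation.AnomalousDissipation.Theorems.SawtoothPulseCascadeK1LocalisedCascadeStartTransfer
import Summits.AnomalousDissipation.AnomalousDissipation.Theorems.SawtoothPulseCascadeConstructionRegular58

/-!
# K1loc, line `Spectral` — S-D (first good piece): THE ENSTROPHY CONSTANT OF THE INVISCID ITERATE

Helper file of the prover lane on the crux `K1LocalisedCascade` (stmt-AnomalousDissipation-19491), route
`SawtoothPulseCascade`, registered line `Cruxes.K1LocalisedCascade.Spectral` (one open stub `stub_highModeConcentration`).
Companion of `…ViscousCoupling` / `…StartTransfer`: the start transfer `…K1Start.sqrt_tsum_symbol_sq_le_of_inviscid` asks for a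
constant `A` bounding the transported enstrophies `∫(∂ᵢa_j)² + ∫(∂ⱼa_j − cU_j′(x_j)∂ᵢa_j)²` (`c ∈ [0,γ]`) of the inviscid iterates on
the first `n` phases.  This file discharges it from a SUP bound on the gradient of the datum:

* §1 `abs_partialDeriv_comp_shearMap_le` — `|∂_l(a ∘ shearMap i j φ)| ≤ (1 + ‖φ′‖_∞)·G` if `|∂_l a| ≤ G` (chain rule
  `…K1Slot.partialDeriv_comp_shearMap`);  `transportedEnstrophy_le_of_abs_partialDeriv_le` — `∫(∂ᵢa)² + ∫(∂ⱼa − cQ(x_j)∂ᵢa)² ≤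
  (1 + (1 + |c|D)²)·G²` if `|∂_l a| ≤ G`, `|Q| ≤ D` (`𝕋²` has volume one);
* §2 the cascade iterate: `|∂_l a_j| ≤ G₀(1+γ)^{2j}`, `|∂_l b_j| ≤ G₀(1+γ)^{2j+1}` (`|U_j′| ≤ 1`,
  `SawtoothCascade.CascadeParams.abs_deriv_U_le_one`), hence the hypotheses `hAH`, `hAV` of `…StartTransfer` with
  **`A = √(1 + (1+γ)²) · G₀ · (1+γ)^{2n}`**;
* §3 the datum `sin 2πx₁`: `|∂_l datum| ≤ 2π` (`datum = S.onCircle ∘ x₀` for the sine profile `S`), and the `hstart`-shaped corollary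
  `sqrt_tsum_symbol_sq_datum_le_of_inviscid`: for every inviscid iterate `(a, b)` of the datum and every symbol `|μ| ≤ 1` with
  `√(Σ′μ²|𝓕aₙ|²) ≤ q`, every classical cascade scalar `w` from the datum with `κ ∈ (0, κ₁]` satisfies
  `√(Σ′μ²|𝓕w(tStart n)|²) ≤ q + (2π√(1+(1+γ)²)(1+γ)^{2n} · √(2κ₁ · tStart n · ‖datum‖²))^{1/2}`.

WHAT THIS IS NOT: no bound on `q` (the window/zone analysis of `aₙ`, memo v8 §1); valid for every `CascadeParams` with `γ ≥ 0`,
`δ₀ > 0`, `d > 0`. [cite: BardosTitiWiedemann2012, Lemma 4 (transport by a shear is composition with the shear map)]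
[cite: DEIJ2022, (1.2)–(1.3)] [problem: turb]
-/

-- `Summit.<Summit>.<Problem>`: single-conjunct summit, the duplicate namespace segment is deliberate.
set_option linter.dupNamespace false

noncomputable section

namespace Summit.AnomalousDissipation.AnomalousDissipation.Theorems.SawtoothPulseCascade.K1Start

open MeasureTheory Set Filter Topology UnitAddTorus Function
open scoped ContDiff InnerProductSpace
open Literature.Analysis Literature.Analysis.FunctionSpaces Literature.Analysis.FunctionSpaces.Torus
open Literature.Analysis.FluidPDE.ShearStage
open Summit.AnomalousDissipation.AnomalousDissipation.Theorems.SawtoothPulseCascade.K1Slot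
open Literature.Analysis.FluidPDE.SawtoothCascade Literature.Analysis.FluidPDE.SawtoothCascade.CascadeParams

/-! ## §1 Sup-gradient bounds through a shear, and the transported enstrophy -/

section Shear

variable {i j : Fin 2}

/-- The circle profile is bounded by any bound of the profile: `|Q.onCircle b| ≤ D` if `|Q y| ≤ D` for all `y`. [folklore] -/
theorem abs_onCircle_le (Q : ShearProfile) {D : ℝ} (hD : ∀ y, |Q y| ≤ D) (b : UnitAddCircle) : |Q.onCircle b| ≤ D := by
  induction b using QuotientAddGroup.induction_on with
  | H y => rw [ShearProfile.onCircle_coe]; exact hD y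

/-- **Sup-gradient propagation through a transversal shear.**  If `|∂_l a| ≤ G` for both `l` and `|φ′| ≤ D` (`Q = φ′`), then
`|∂_l (a ∘ shearMap i j φ)| ≤ (1 + D)·G` for both `l` (`i ≠ j`; chain rule `∂_l(a∘Φ) = (∂_l a)∘Φ − [l=j] φ′(x_j)(∂ᵢa)∘Φ`).
[cite: BardosTitiWiedemann2012, Lemma 4] -/
theorem abs_partialDeriv_comp_shearMap_le (hij : i ≠ j) (P Q : ShearProfile) (hQ : ∀ y, Q y = deriv P y)
    {a : UnitAddTorus (Fin 2) → ℝ} (ha : IsSmooth a) {G D : ℝ} (hG0 : 0 ≤ G) (hD0 : 0 ≤ D)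
    (hG : ∀ l x, |partialDeriv l a x| ≤ G) (hD : ∀ y, |Q y| ≤ D) (l : Fin 2) (x : UnitAddTorus (Fin 2)) :
    |partialDeriv l (a ∘ shearMap i j P) x| ≤ (1 + D) * G := by
  rw [partialDeriv_comp_shearMap ha i j P l x]
  by_cases hl : l = j
  · subst hl
    rw [if_pos rfl, partialDeriv_onCircle_comp_eq P Q hQ x, smul_eq_mul]
    have h1 := hG l (shearMap i l P x)
    have h2 := hG i (shearMap i l P x)
    have h3 := abs_onCircle_le Q hD (x l)
    calc |partialDeriv l a (shearMap i l P x) - Q.onCircle (x l) * partialDeriv i a (shearMap i l P x)|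
        ≤ |partialDeriv l a (shearMap i l P x)| + |Q.onCircle (x l) * partialDeriv i a (shearMap i l P x)| :=
          abs_sub _ _
      _ ≤ G + D * G := by
          rw [abs_mul]; exact add_le_add h1 (mul_le_mul h3 h2 (abs_nonneg _) hD0)
      _ = (1 + D) * G := by ring
  · rw [if_neg hl, sub_zero]
    calc |partialDeriv l a (shearMap i j P x)| ≤ G := hG l _
      _ = (1 + 0) * G := by ring
      _ ≤ (1 + D) * G := by nlinarith

/-- The derivative profile of a scaled profile: `(c•Q) = (c•φ)′` if `Q = φ′`. [folklore] -/
theorem amp_eq_deriv_amp (P Q : ShearProfile) (hQ : ∀ y, Q y = deriv P y) (c y : ℝ) :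
    amp Q c y = deriv (amp P c) y := by
  rw [amp_apply, hQ]
  change c * deriv P y = deriv (fun s => c * P s) y
  exact (((hasDerivAt_profile P y).const_mul c).deriv).symm

/-- **Transported enstrophy from a sup-gradient bound.**  On `𝕋²` (volume one): if `|∂_l a| ≤ G` for both `l` and
`|Q| ≤ D`, then `∫(∂ᵢa)² + ∫(∂ⱼa − c Q(x_j) ∂ᵢa)² ≤ (1 + (1 + |c| D)²) G²`. [folklore] -/
theorem transportedEnstrophy_le_of_abs_partialDeriv_le (Q : ShearProfile) {a : UnitAddTorus (Fin 2) → ℝ} (ha : IsSmooth a)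
    {G D : ℝ} (hD0 : 0 ≤ D) (hG : ∀ l x, |partialDeriv l a x| ≤ G) (hD : ∀ y, |Q y| ≤ D) (c : ℝ) :
    (∫ x, partialDeriv i a x ^ 2) + ∫ x, (partialDeriv j a x - c * Q.onCircle (x j) * partialDeriv i a x) ^ 2 ≤
      (1 + (1 + |c| * D) ^ 2) * G ^ 2 := by
  have h1 : ∀ x, partialDeriv i a x ^ 2 ≤ G ^ 2 := fun x => by
    rw [← sq_abs]; exact pow_le_pow_left₀ (abs_nonneg _) (hG i x) 2
  have h2 : ∀ x, (partialDeriv j a x - c * Q.onCircle (x j) * partialDeriv i a x) ^ 2 ≤ ((1 + |c| * D) * G) ^ 2 := fun x => by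
    rw [← sq_abs]
    refine pow_le_pow_left₀ (abs_nonneg _) ?_ 2
    calc |partialDeriv j a x - c * Q.onCircle (x j) * partialDeriv i a x|
        ≤ |partialDeriv j a x| + |c * Q.onCircle (x j) * partialDeriv i a x| := abs_sub _ _
      _ ≤ G + |c| * D * G := by
          rw [abs_mul, abs_mul]
          exact add_le_add (hG j x) (mul_le_mul (mul_le_mul_of_nonneg_left (abs_onCircle_le Q hD (x j)) (abs_nonneg c))
            (hG i x) (abs_nonneg _) (by positivity))
      _ = (1 + |c| * D) * G := by ring
  have hi1 : IsSmooth (fun x => partialDeriv i a x ^ 2) := (ha.partialDeriv i).pow 2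
  have hi2 : IsSmooth (fun x => (partialDeriv j a x - c * Q.onCircle (x j) * partialDeriv i a x) ^ 2) :=
    (isSmooth_slotDeriv (i := i) (j := j) Q c ha).pow 2
  have I1 : ∫ x, partialDeriv i a x ^ 2 ≤ G ^ 2 := by
    refine (integral_mono hi1.integrable (integrable_const _) h1).trans ?_
    rw [integral_const, smul_eq_mul]
    simp [Measure.real]
  have I2 : ∫ x, (partialDeriv j a x - c * Q.onCircle (x j) * partialDeriv i a x) ^ 2 ≤ ((1 + |c| * D) * G) ^ 2 := by
    refine (integral_mono hi2.integrable (integrable_const _) h2).trans ?_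
    rw [integral_const, smul_eq_mul]
    simp [Measure.real]
  nlinarith

end Shear

/-! ## §2 The cascade iterate: gradient growth `(1+γ)` per half-phase and the enstrophy constant -/

section Cascade

variable (P : CascadeParams)

/-- The derivative profile `U_j′` as a `ShearProfile` (smooth, `1`-periodic) with `|U_j′| ≤ 1`
(`SawtoothCascade.CascadeParams.abs_deriv_U_le_one`). [cite: ElgindiLissMattingly2025, §1 (slope ±1 profiles)] -/
theorem exists_deriv_profile {j : ℕ} (hδ : 0 < P.δ j) :
    ∃ Q : ShearProfile, (∀ y, Q y = deriv (P.U j) y) ∧ ∀ y, |Q y| ≤ 1 := by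
  have hper : Function.Periodic (deriv (P.U j)) 1 := fun s => by
    have h : (fun y => P.U j (y + 1)) = P.U j := funext (P.U_periodic j)
    rw [← deriv_comp_add_const, h]
  have hcd : ContDiff ℝ ∞ (deriv (P.U j)) := (contDiff_infty_iff_deriv.1 (P.contDiff_U hδ)).2
  exact ⟨⟨deriv (P.U j), hper, hcd⟩, fun _ => rfl, fun y => P.abs_deriv_U_le_one hδ y⟩

/-- **Gradient growth of the inviscid iterate.**  If `|∂_l a₀| ≤ G₀` then `|∂_l a_j| ≤ G₀(1+γ)^{2j}` and `|∂_l b_j| ≤ G₀(1+γ)^{2j+1}`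
for the inviscid iterate `b j = a j ∘ shearMap 0 1 (γ•U_j)`, `a (j+1) = b j ∘ shearMap 1 0 (γ•U_j)` (`γ ≥ 0`, `|U_j′| ≤ 1`).
[cite: BardosTitiWiedemann2012, Lemma 4] -/
theorem abs_partialDeriv_iterate_le (hγ : 0 ≤ P.γ) (hδ₀ : 0 < P.δ₀) (hd : 0 < P.d)
    (a b : ℕ → UnitAddTorus (Fin 2) → ℝ) (has : ∀ j, IsSmooth (a j))
    (hb : ∀ j, b j = a j ∘ shearMap 0 1 (amp ⟨P.U j, P.U_periodic j, P.contDiff_U (P.δ_pos hδ₀ hd j)⟩ P.γ))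
    (hab : ∀ j, a (j + 1) = b j ∘ shearMap 1 0 (amp ⟨P.U j, P.U_periodic j, P.contDiff_U (P.δ_pos hδ₀ hd j)⟩ P.γ))
    {G₀ : ℝ} (hG₀ : 0 ≤ G₀) (hG : ∀ l x, |partialDeriv l (a 0) x| ≤ G₀) (j : ℕ) :
    (∀ l x, |partialDeriv l (a j) x| ≤ G₀ * (1 + P.γ) ^ (2 * j)) ∧
      ∀ l x, |partialDeriv l (b j) x| ≤ G₀ * (1 + P.γ) ^ (2 * j + 1) := by
  -- the derivative profile of `U_j` and its bound
  have hQ : ∀ j, ∃ Q : ShearProfile, (∀ y, Q y = deriv (P.U j) y) ∧ ∀ y, |Q y| ≤ 1 := fun j =>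
    exists_deriv_profile P (P.δ_pos hδ₀ hd j)
  -- one half-phase: `a ∘ shearMap i j (γ•U)` grows the sup-gradient by `1 + γ`
  have step : ∀ (i i' : Fin 2) (hii : i ≠ i') (m : ℕ) {f : UnitAddTorus (Fin 2) → ℝ} (hf : IsSmooth f) {G : ℝ}
      (hG0 : 0 ≤ G) (hfG : ∀ l x, |partialDeriv l f x| ≤ G),
      ∀ l x, |partialDeriv l (f ∘ shearMap i i' (amp ⟨P.U m, P.U_periodic m, P.contDiff_U (P.δ_pos hδ₀ hd m)⟩ P.γ)) x| ≤
        G * (1 + P.γ) := by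
    intro i i' hii m f hf G hG0 hfG l x
    obtain ⟨Q, hQd, hQ1⟩ := hQ m
    have hQa : ∀ y, amp Q P.γ y = deriv (amp ⟨P.U m, P.U_periodic m, P.contDiff_U (P.δ_pos hδ₀ hd m)⟩ P.γ) y :=
      fun y => amp_eq_deriv_amp ⟨P.U m, P.U_periodic m, P.contDiff_U (P.δ_pos hδ₀ hd m)⟩ Q hQd P.γ y
    have hDa : ∀ y, |amp Q P.γ y| ≤ P.γ := fun y => by
      rw [amp_apply, abs_mul, abs_of_nonneg hγ]
      exact (mul_le_mul_of_nonneg_left (hQ1 y) hγ).trans_eq (mul_one _)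
    have h := abs_partialDeriv_comp_shearMap_le hii _ (amp Q P.γ) hQa hf hG0 hγ hfG hDa l x
    linarith
  induction j with
  | zero =>
    refine ⟨fun l x => by simpa using hG l x, fun l x => ?_⟩
    rw [hb 0]
    have h := step 0 1 (by decide) 0 (has 0) hG₀ (fun l x => by simpa using hG l x) l x
    simpa using h
  | succ n ih =>
    have hbn : IsSmooth (b n) := by rw [hb n]; exact (has n).comp_shearMap 0 1 _
    have hGn : 0 ≤ G₀ * (1 + P.γ) ^ (2 * n + 1) := by positivity
    have ha' : ∀ l x, |partialDeriv l (a (n + 1)) x| ≤ G₀ * (1 + P.γ) ^ (2 * (n + 1)) := fun l x => by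
      rw [hab n]
      have h := step 1 0 (by decide) n hbn hGn ih.2 l x
      rw [show 2 * (n + 1) = (2 * n + 1) + 1 by ring, pow_succ, ← mul_assoc]
      exact h
    refine ⟨ha', fun l x => ?_⟩
    rw [hb (n + 1)]
    have h := step 0 1 (by decide) (n + 1) (has (n + 1)) (by positivity) ha' l x
    rw [show 2 * (n + 1) + 1 = 2 * (n + 1) + 1 from rfl, pow_succ, ← mul_assoc]
    exact h

/-- **The enstrophy constant of the inviscid iterate.**  With `|∂_l a₀| ≤ G₀` the hypotheses `hAH`, `hAV` of `…StartTransfer` hold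
on the first `n` phases with `A = √(1 + (1+γ)²) · G₀ · (1+γ)^{2n}`. [cite: BardosTitiWiedemann2012, Lemma 4] -/
theorem transportedEnstrophy_iterate_le (hγ : 0 ≤ P.γ) (hδ₀ : 0 < P.δ₀) (hd : 0 < P.d) (Q : ℕ → ShearProfile)
    (hQ : ∀ j y, Q j y = deriv (P.U j) y) (a b : ℕ → UnitAddTorus (Fin 2) → ℝ) (has : ∀ j, IsSmooth (a j))
    (hb : ∀ j, b j = a j ∘ shearMap 0 1 (amp ⟨P.U j, P.U_periodic j, P.contDiff_U (P.δ_pos hδ₀ hd j)⟩ P.γ))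
    (hab : ∀ j, a (j + 1) = b j ∘ shearMap 1 0 (amp ⟨P.U j, P.U_periodic j, P.contDiff_U (P.δ_pos hδ₀ hd j)⟩ P.γ))
    {G₀ : ℝ} (hG₀ : 0 ≤ G₀) (hG : ∀ l x, |partialDeriv l (a 0) x| ≤ G₀) (n : ℕ) :
    (∀ j < n, ∀ c ∈ Icc 0 P.γ, (∫ x, partialDeriv (0 : Fin 2) (a j) x ^ 2) +
        ∫ x, (partialDeriv (1 : Fin 2) (a j) x - c * (Q j).onCircle (x 1) * partialDeriv (0 : Fin 2) (a j) x) ^ 2 ≤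
          (Real.sqrt (1 + (1 + P.γ) ^ 2) * G₀ * (1 + P.γ) ^ (2 * n)) ^ 2) ∧
      ∀ j < n, ∀ c ∈ Icc 0 P.γ, (∫ x, partialDeriv (1 : Fin 2) (b j) x ^ 2) +
        ∫ x, (partialDeriv (0 : Fin 2) (b j) x - c * (Q j).onCircle (x 0) * partialDeriv (1 : Fin 2) (b j) x) ^ 2 ≤
          (Real.sqrt (1 + (1 + P.γ) ^ 2) * G₀ * (1 + P.γ) ^ (2 * n)) ^ 2 := by
  have hQ1 : ∀ j y, |Q j y| ≤ 1 := fun j y => by rw [hQ j y]; exact P.abs_deriv_U_le_one (P.δ_pos hδ₀ hd j) y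
  have hsq : Real.sqrt (1 + (1 + P.γ) ^ 2) ^ 2 = 1 + (1 + P.γ) ^ 2 := Real.sq_sqrt (by positivity)
  have hγ1 : 1 ≤ 1 + P.γ := by linarith
  -- `(1 + c)^2 ≤ (1+γ)^2` for `c ∈ [0, γ]`, and the monotonicity of the powers
  have hc2 : ∀ c ∈ Icc 0 P.γ, 1 + (1 + |c| * 1) ^ 2 ≤ 1 + (1 + P.γ) ^ 2 := fun c hc => by
    rw [abs_of_nonneg hc.1, mul_one]; nlinarith [hc.1, hc.2]
  constructor
  · intro j hj c hc
    have hGj := (abs_partialDeriv_iterate_le P hγ hδ₀ hd a b has hb hab hG₀ hG j).1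
    have h := transportedEnstrophy_le_of_abs_partialDeriv_le (i := 0) (j := 1) (Q j) (has j) zero_le_one hGj (hQ1 j) c
    refine h.trans ?_
    have hpow : (G₀ * (1 + P.γ) ^ (2 * j)) ^ 2 ≤ (G₀ * (1 + P.γ) ^ (2 * n)) ^ 2 :=
      pow_le_pow_left₀ (by positivity) (mul_le_mul_of_nonneg_left (pow_le_pow_right₀ hγ1 (by omega)) hG₀) 2
    calc (1 + (1 + |c| * 1) ^ 2) * (G₀ * (1 + P.γ) ^ (2 * j)) ^ 2
        ≤ (1 + (1 + P.γ) ^ 2) * (G₀ * (1 + P.γ) ^ (2 * n)) ^ 2 :=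
          mul_le_mul (hc2 c hc) hpow (by positivity) (by positivity)
      _ = (Real.sqrt (1 + (1 + P.γ) ^ 2) * G₀ * (1 + P.γ) ^ (2 * n)) ^ 2 := by
          linear_combination (-(G₀ * (1 + P.γ) ^ (2 * n)) ^ 2) * hsq
  · intro j hj c hc
    have hbj : IsSmooth (b j) := by rw [hb j]; exact (has j).comp_shearMap 0 1 _
    have hGj := (abs_partialDeriv_iterate_le P hγ hδ₀ hd a b has hb hab hG₀ hG j).2
    have h := transportedEnstrophy_le_of_abs_partialDeriv_le (i := 1) (j := 0) (Q j) hbj zero_le_one hGj (hQ1 j) c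
    refine h.trans ?_
    have hpow : (G₀ * (1 + P.γ) ^ (2 * j + 1)) ^ 2 ≤ (G₀ * (1 + P.γ) ^ (2 * n)) ^ 2 :=
      pow_le_pow_left₀ (by positivity) (mul_le_mul_of_nonneg_left (pow_le_pow_right₀ hγ1 (by omega)) hG₀) 2
    calc (1 + (1 + |c| * 1) ^ 2) * (G₀ * (1 + P.γ) ^ (2 * j + 1)) ^ 2
        ≤ (1 + (1 + P.γ) ^ 2) * (G₀ * (1 + P.γ) ^ (2 * n)) ^ 2 :=
          mul_le_mul (hc2 c hc) hpow (by positivity) (by positivity)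
      _ = (Real.sqrt (1 + (1 + P.γ) ^ 2) * G₀ * (1 + P.γ) ^ (2 * n)) ^ 2 := by
          linear_combination (-(G₀ * (1 + P.γ) ^ (2 * n)) ^ 2) * hsq

/-! ## §3 The datum `sin 2πx₁` and the start socket for the cascade -/

/-- The sine profile `s ↦ sin 2πs` as a `ShearProfile` term inside proofs is avoided (no definitions in proof files); instead:
**the datum is a function of `x₀` alone with gradient `≤ 2π`**: `|∂_l datum| ≤ 2π` for both `l`. [folklore] -/
theorem abs_partialDeriv_datum_le (l : Fin 2) (x : UnitAddTorus (Fin 2)) : |partialDeriv l datum x| ≤ 2 * Real.pi := by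
  -- the datum read through the sine profile
  have hper : Function.Periodic (fun s : ℝ => Real.sin (2 * Real.pi * s)) 1 := fun s => by
    simp [mul_add, Real.sin_add_two_pi]
  have hcd : ContDiff ℝ ∞ (fun s : ℝ => Real.sin (2 * Real.pi * s)) := Real.contDiff_sin.comp (contDiff_const.mul contDiff_id)
  set S : ShearProfile := ⟨fun s => Real.sin (2 * Real.pi * s), hper, hcd⟩ with hS
  have hdatum : datum = fun x : UnitAddTorus (Fin 2) => S.onCircle (x 0) := by
    funext x
    have hx : ((Torus.repr x 0 : ℝ) : UnitAddCircle) = x 0 := by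
      have h := congrFun (Torus.proj_repr x) 0
      rwa [Torus.proj_apply] at h
    rw [← hx, ShearProfile.onCircle_coe]; rfl
  obtain ⟨y, rfl⟩ := proj_surjective x
  rw [hdatum, partialDeriv_onCircle_comp]
  by_cases hl : l = 0
  · rw [if_pos hl]
    have hd : deriv S (y 0) = 2 * Real.pi * Real.cos (2 * Real.pi * y 0) := by
      change deriv (fun s => Real.sin (2 * Real.pi * s)) (y 0) = _
      have h : HasDerivAt (fun s => Real.sin (2 * Real.pi * s)) (Real.cos (2 * Real.pi * y 0) * (2 * Real.pi * 1)) (y 0) :=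
        ((hasDerivAt_id (y 0)).const_mul (2 * Real.pi)).sin
      rw [h.deriv]; ring
    rw [hd, abs_mul, abs_of_pos Real.two_pi_pos]
    exact (mul_le_mul_of_nonneg_left (Real.abs_cos_le_one _) Real.two_pi_pos.le).trans_eq (mul_one _)
  · rw [if_neg hl, abs_zero]; positivity

/-- **The start socket for the cascade datum (`hstart` shape).**  Let `(a, b)` be the inviscid iterate of the datum
(`a 0 = datum`, `b j = a j ∘ shearMap 0 1 (γ•U_j)`, `a (j+1) = b j ∘ shearMap 1 0 (γ•U_j)`), `μ` a real symbol with `|μ| ≤ 1`,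
`√(Σ′ μ²|𝓕aₙ|²) ≤ q`, and `κ₁` a threshold.  Then every classical cascade scalar `w` on `[0,1)` from the datum with `κ ∈ (0, κ₁]` satisfies
`√(Σ′ μ(k)²|𝓕(w(tStart n))(k)|²) ≤ q + (2π√(1+(1+γ)²)(1+γ)^{2n} · √(2κ₁ · tStart n · ‖datum‖²))^{1/2}` — the hypothesis `hstart` of
`…K1Ledger.highModeConcentration_of_ledger_threshold` (`i₀ = n`) from ONE bound on ONE explicit function.
[cite: DEIJ2022, (1.2)–(1.3)] [cite: Grafakos2014, Prop. 3.2.7 (3)] -/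
theorem sqrt_tsum_symbol_sq_datum_le_of_inviscid (hγ : 0 ≤ P.γ) (hδ₀ : 0 < P.δ₀) (hd : 0 < P.d)
    (a b : ℕ → UnitAddTorus (Fin 2) → ℝ) (has : ∀ j, IsSmooth (a j)) (h0 : a 0 = datum)
    (hb : ∀ j, b j = a j ∘ shearMap 0 1 (amp ⟨P.U j, P.U_periodic j, P.contDiff_U (P.δ_pos hδ₀ hd j)⟩ P.γ))
    (hab : ∀ j, a (j + 1) = b j ∘ shearMap 1 0 (amp ⟨P.U j, P.U_periodic j, P.contDiff_U (P.δ_pos hδ₀ hd j)⟩ P.γ))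
    (n : ℕ) (μ : (Fin 2 → ℤ) → ℝ) (hμ : ∀ k, |μ k| ≤ 1) {q κ₁ : ℝ}
    (hq : Real.sqrt (∑' k, μ k ^ 2 * ‖mFourierCoeff (fun x => (a n x : ℂ)) k‖ ^ 2) ≤ q) :
    ∀ κ ∈ Ioc (0 : ℝ) κ₁, ∀ w : ℝ → UnitAddTorus (Fin 2) → ℝ,
      FluidPDE.Torus.IsClassicalScalarTransportOn (Ico 0 1) κ P.field w → w 0 = datum →
        Real.sqrt (∑' k, μ k ^ 2 * ‖mFourierCoeff (fun x => (w (tStart n) x : ℂ)) k‖ ^ 2) ≤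
          q + Real.sqrt (2 * Real.pi * Real.sqrt (1 + (1 + P.γ) ^ 2) * (1 + P.γ) ^ (2 * n) *
            Real.sqrt (2 * κ₁ * tStart n * FluidPDE.Torus.scalarL2Sq datum)) := by
  -- the derivative profiles of the `U_j`
  have hQe : ∀ j, ∃ Q : ShearProfile, (∀ y, Q y = deriv (P.U j) y) ∧ ∀ y, |Q y| ≤ 1 := fun j =>
    exists_deriv_profile P (P.δ_pos hδ₀ hd j)
  choose Q hQd _hQ1 using hQe
  have hG : ∀ l x, |partialDeriv l (a 0) x| ≤ 2 * Real.pi := fun l x => by rw [h0]; exact abs_partialDeriv_datum_le l x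
  have hA := transportedEnstrophy_iterate_le P hγ hδ₀ hd Q hQd a b has hb hab Real.two_pi_pos.le hG n
  have h := sqrt_tsum_symbol_sq_le_of_inviscid P hγ hδ₀ hd Q hQd (A := Real.sqrt (1 + (1 + P.γ) ^ 2) * (2 * Real.pi) *
    (1 + P.γ) ^ (2 * n)) (by positivity) a b has h0 hb hab n hA.1 hA.2 μ hμ (q := q) (κ₁ := κ₁) hq
  rw [show Real.sqrt (1 + (1 + P.γ) ^ 2) * (2 * Real.pi) * (1 + P.γ) ^ (2 * n) =
      2 * Real.pi * Real.sqrt (1 + (1 + P.γ) ^ 2) * (1 + P.γ) ^ (2 * n) by ring] at h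
  exact h

end Cascade

end Summit.AnomalousDissipation.AnomalousDissipation.Theorems.SawtoothPulseCascade.K1Start
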